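import Summits.QuantumFields.YangMills.Theses.ConvexGribovBody
import Summits.QuantumFields.YangMills.Theorems.HypercubicLimit.Negative.NonabelianLoadBearing
import Summits.QuantumFields.YangMills.Theorems.ContinuumLegGivenGap.Negative.LinearLoadBearing
import Literature.MathematicalPhysics.QuantumFieldTheory.LatticeGaugeProofs

/-!
# `ContinuumLegGivenGap` (stmt-QuantumFields-15828, RE-TYPED) — negative-side support: per-group burden,
# non-abelianness and linearity are load-bearing, in the re-typed shape

Support file for crux `stmt-QuantumFields-15828` (`Summit.QuantumFields.YangMills.Theses.ConvexGribovBody.ContinuumLegGivenGap`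
after the 2026-08-16 re-type: conclusion `sch.HasWeakCouplingLimit ∧ IsYangMillsFor r sch T ∧ …`; twins in
SmallCircleAnchor / HyperbolicRegulator / ContractibleFibre), extracted from the standing disprover's work file
`Cruxes/ContinuumLegGivenGap/Disproof.lean` (gen 2, §0, §2).  It is the re-typed companion of
`Negative/PerGroupBurden.lean` (typed on the predecessor stmt-8782), which this file deliberately does NOT import.
Tree objects only, nothing posited, no `def`; hypothesis ("GapHypAt") and conclusion ("Concl") written out verbatim.

* `exists_gapHyp_not_concl_weak_of_not_continuumLegGivenGap`: the disproof burden — a refutation exhibits ONE compact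
  simple `G` with the volume-uniform weak-coupling lattice gap in EVERY faithful `r` and no Clay witness (re-typed).
* `continuumLegGivenGap_weak_false_without_nonabelian`: with `IsCompactSimpleLieGroup` weakened to "connected ∧
  linear" the re-typed crux is FALSE (`G = PUnit`: the hypothesis holds — all connected torus correlations vanish —
  and non-triviality fails for EVERY scheme, weak-coupling or not; landed
  `not_converges_and_twoPointNontrivial_of_subsingleton`).
* `continuumLegGivenGap_weak_false_without_linear`: with `IsCompactSimpleLieGroup` weakened to `IsSimpleCompactGroup`
  the re-typed crux is FALSE (`D₃` indiscrete: hypothesis vacuous, landed `isEmpty_latticeRep_indiscrete`; conclusion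
  needs a representation). [folklore]
-/

noncomputable section

open scoped SchwartzMap
open Filter Topology MeasureTheory
open Literature.MathematicalPhysics.AQFT Literature.MathematicalPhysics.QuantumLattice
open Literature.MathematicalPhysics.QuantumFieldTheory
open Summit.QuantumFields.YangMills.Theses
open Summit.QuantumFields.YangMills.Theorems.HypercubicLimit.Negative

namespace Summit.QuantumFields.YangMills.Theorems.ContinuumLegGivenGap.Negative

/-- **What a refutation of the re-typed `ContinuumLegGivenGap` must exhibit**: ONE compact simple Lie group `G` such
that (i) Wilson's lattice theory of `G` has the volume-uniform weak-coupling mass gap in EVERY faithful unitary `r`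
(open beyond strong coupling for every non-abelian `G` in `d = 4`) and (ii) Clay's statement for `G` — weak-coupling
scheme, OS data tied to the lattice, non-trivial and non-Gaussian `tr F²`, both gaps — is FALSE. [folklore] -/
theorem exists_gapHyp_not_concl_weak_of_not_continuumLegGivenGap (h : ¬ ConvexGribovBody.ContinuumLegGivenGap) :
    ∃ (G : Type) (_ : Group G) (_ : TopologicalSpace G) (_ : IsTopologicalGroup G) (_ : CompactSpace G),
      IsCompactSimpleLieGroup G ∧
        letI : MeasurableSpace G := borel G
        haveI : BorelSpace G := ⟨rfl⟩
        (∀ r : LatticeRep G, ∃ β₀ : ℝ, ∀ β : ℝ, β₀ ≤ β → ∃ m : ℝ, 0 < m ∧ ∃ S₁ : ℕ,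
          ∀ A B : YMSpecies G, ∃ C : ℝ, ∀ S n : ℕ, S₁ ≤ S → n ≤ S →
            |latticeConnectedCorr r.ρ β (2 * S + 1) A.F B.F n| ≤ C * Real.exp (-(m * n))) ∧
        ¬ ∃ (r : LatticeRep G) (sch : SpeciesScheme (YMSpecies G)) (T : OSData (YMSpecies G) 4),
            sch.HasWeakCouplingLimit ∧ IsYangMillsFor r sch T ∧ T.IsNontrivial r.curvature ∧
              T.IsNonGaussian r.curvature ∧ ∃ Δ > 0, T.HasMassGap Δ ∧ HasLatticeMassGap r sch Δ := by
  by_contra hne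
  refine h fun G _ _ _ _ hG hgap => ?_
  by_contra hc
  exact hne ⟨G, _, _, _, _, hG, hgap, hc⟩

/-- **The re-typed crux is false without "non-abelian".**  Weakening `IsCompactSimpleLieGroup G` to "compact,
connected, with a faithful continuous unitary representation" makes the statement FALSE: for `G = PUnit` the
hypothesis holds (every observable is deterministic under the probability Wilson measure, so all connected torus
correlations vanish: rate `1`, threshold `0`, constant `0`) while the conclusion fails for EVERY scheme and every OS
datum (`IsYangMillsFor` forces the curvature two-point function to factorise on real off-diagonal tensors;
real→complex bridge).  So any proof uses non-abelianness, and the hypothesis alone — even with `β_k → ∞` — does not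
manufacture an interacting limit. [folklore] -/
theorem continuumLegGivenGap_weak_false_without_nonabelian :
    ¬ (∀ (G : Type) [Group G] [TopologicalSpace G] [IsTopologicalGroup G] [CompactSpace G],
        ConnectedSpace G → Nonempty (LatticeRep G) →
          letI : MeasurableSpace G := borel G
          haveI : BorelSpace G := ⟨rfl⟩
          (∀ r : LatticeRep G, ∃ β₀ : ℝ, ∀ β : ℝ, β₀ ≤ β → ∃ m : ℝ, 0 < m ∧ ∃ S₁ : ℕ,
            ∀ A B : YMSpecies G, ∃ C : ℝ, ∀ S n : ℕ, S₁ ≤ S → n ≤ S →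
              |latticeConnectedCorr r.ρ β (2 * S + 1) A.F B.F n| ≤ C * Real.exp (-(m * n))) →
          ∃ (r : LatticeRep G) (sch : SpeciesScheme (YMSpecies G)) (T : OSData (YMSpecies G) 4),
            sch.HasWeakCouplingLimit ∧ IsYangMillsFor r sch T ∧ T.IsNontrivial r.curvature ∧
              T.IsNonGaussian r.curvature ∧ ∃ Δ > 0, T.HasMassGap Δ ∧ HasLatticeMassGap r sch Δ) := by
  intro h
  letI : MeasurableSpace PUnit := borel PUnit
  haveI : BorelSpace PUnit := ⟨rfl⟩
  -- all connected torus correlations vanish for the trivial group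
  have hzero : ∀ (r : LatticeRep PUnit) (β : ℝ) (S : ℕ) (A B : LGConfig 4 PUnit → ℝ) (n : ℕ),
      latticeConnectedCorr r.ρ β (2 * S + 1) A B n = 0 := by
    intro r β S A B n
    haveI := isProbabilityMeasure_wilsonMeasure (d := 4) (L := 2 * S + 1) r.ρ r.continuous β
    have hconst : ∀ (g : GaugeConfig 4 (2 * S + 1) PUnit → ℝ) (U₀ : GaugeConfig 4 (2 * S + 1) PUnit),
        ∫ U, g U ∂(wilsonMeasure (d := 4) (L := 2 * S + 1) r.ρ β) = g U₀ := by
      intro g U₀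
      have hc : (fun U => g U) = fun _ => g U₀ := funext fun U => congrArg g (Subsingleton.elim U U₀)
      rw [hc, integral_const, smul_eq_mul, probReal_univ, one_mul]
    set U₀ : GaugeConfig 4 (2 * S + 1) PUnit := fun _ => PUnit.unit
    unfold latticeConnectedCorr
    rw [hconst (fun U => A (torusLift (2 * S + 1) U) *
        B (configShift (-Pi.single 0 (n : ℤ)) (torusLift (2 * S + 1) U))) U₀,
      hconst (fun U => A (torusLift (2 * S + 1) U)) U₀, hconst (fun U => B (torusLift (2 * S + 1) U)) U₀]
    have hB : B (configShift (-Pi.single 0 (n : ℤ)) (torusLift (2 * S + 1) U₀)) = B (torusLift (2 * S + 1) U₀) :=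
      congrArg B (Subsingleton.elim _ _)
    rw [hB, sub_self]
  have hgap : ∀ r : LatticeRep PUnit, ∃ β₀ : ℝ, ∀ β : ℝ, β₀ ≤ β → ∃ m : ℝ, 0 < m ∧ ∃ S₁ : ℕ,
      ∀ A B : YMSpecies PUnit, ∃ C : ℝ, ∀ S n : ℕ, S₁ ≤ S → n ≤ S →
        |latticeConnectedCorr r.ρ β (2 * S + 1) A.F B.F n| ≤ C * Real.exp (-(m * n)) :=
    fun r => ⟨0, fun β _ => ⟨1, one_pos, 0, fun A B => ⟨0, fun S n _ _ => by
      rw [hzero r β S A.F B.F n, abs_zero, zero_mul]⟩⟩⟩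
  obtain ⟨r, sch, T, -, hYM, hnt, -, -⟩ := h PUnit inferInstance ⟨punitRep⟩ hgap
  exact not_converges_and_twoPointNontrivial_of_subsingleton r sch T.schwinger hYM hnt

/-- **The re-typed crux is false without linearity.**  With `IsCompactSimpleLieGroup G` weakened to
`IsSimpleCompactGroup G` the statement FAILS at `G = D₃` with the indiscrete topology: `IsSimpleCompactGroup D₃`
(`isSimpleCompactGroup_indiscrete`), the clustering hypothesis holds vacuously (`LatticeRep D₃` is empty,
`isEmpty_latticeRep_indiscrete`), and the conclusion asks for a lattice representation. [folklore] -/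
theorem continuumLegGivenGap_weak_false_without_linear :
    ¬ (∀ (G : Type) [Group G] [TopologicalSpace G] [IsTopologicalGroup G] [CompactSpace G],
        IsSimpleCompactGroup G →
          letI : MeasurableSpace G := borel G
          haveI : BorelSpace G := ⟨rfl⟩
          (∀ r : LatticeRep G, ∃ β₀ : ℝ, ∀ β : ℝ, β₀ ≤ β → ∃ m : ℝ, 0 < m ∧ ∃ S₁ : ℕ,
            ∀ A B : YMSpecies G, ∃ C : ℝ, ∀ S n : ℕ, S₁ ≤ S → n ≤ S →
              |latticeConnectedCorr r.ρ β (2 * S + 1) A.F B.F n| ≤ C * Real.exp (-(m * n))) →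
          ∃ (r : LatticeRep G) (sch : SpeciesScheme (YMSpecies G)) (T : OSData (YMSpecies G) 4),
            sch.HasWeakCouplingLimit ∧ IsYangMillsFor r sch T ∧ T.IsNontrivial r.curvature ∧
              T.IsNonGaussian r.curvature ∧ ∃ Δ > 0, T.HasMassGap Δ ∧ HasLatticeMassGap r sch Δ) := by
  intro h
  letI : TopologicalSpace (DihedralGroup 3) := ⊤
  haveI : IsTopologicalGroup (DihedralGroup 3) :=
    { continuous_mul := continuous_top, continuous_inv := continuous_top }
  letI : MeasurableSpace (DihedralGroup 3) := borel _
  haveI : BorelSpace (DihedralGroup 3) := ⟨rfl⟩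
  have hna : ∃ a b : DihedralGroup 3, a * b ≠ b * a :=
    ⟨DihedralGroup.r 1, DihedralGroup.sr 0, by decide⟩
  have hE := isEmpty_latticeRep_indiscrete (DihedralGroup 3)
  obtain ⟨r, -⟩ := h (DihedralGroup 3)
    (Summit.QuantumFields.QCD.Theorems.YangMills.Negative.isSimpleCompactGroup_indiscrete _ hna)
    (fun r => (hE.false r).elim)
  exact hE.false r

end Summit.QuantumFields.YangMills.Theorems.ContinuumLegGivenGap.Negative

end
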